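import Literature.NumberTheory.GaloisRepresentations.IdeleClassCharacterPairingEmbedded
import Literature.NumberTheory.GaloisRepresentations.GlobalReciprocityModPowersLayers
import Literature.NumberTheory.GaloisRepresentations.GlobalReciprocityBidualityLayers
import HarnessLib

/-!
# Milne I Thm. 1.8 (b)'s hypothesis «`α¹(Γ_F, ℤ/m)` is bijective» for the idèle class formation, in finite-layer
# currency: the pairing `(x, χ) ↦ inv_{L/F}(ι[x] ∪ β_m[χ])` over the finite abelian layers `L ⊆ F̄` has left kernel
# `C_Fᵐ` and every compatible functional on the characters is represented by an idèle (Tate C–F VII §11.3, §5; Milne I 1.8)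

Topic `NumberTheory/GaloisRepresentations`; namespace `Literature.NumberTheory.GaloisRepresentations.IdeleCohomology`.
Theorems only (no definition, no named fact, no instance, no notation, no `sorry`); number fields in `Type`.  Capstone of
door-c6 g14's four files: `IdeleClassCharacterPairing(Embedded)` (the values `inv_{L/F}(ι[x] ∪ β_m[χ]) = −χ(ψ_{L|F} x)/m`),
`GlobalReciprocityModPowersLayers` (injectivity), `GlobalReciprocityBidualityLayers` (surjectivity).

For a class formation `(G, C)` Milne (*ADT* I Thm. 1.8 (b)) reduces Tate's duality theorem for finite modules to:
`α¹(U, ℤ/m) : Ext¹_U(ℤ/m, C) → H¹(U, ℤ/m)^*` is bijective for all open `U` and all `m`.  For `(Γ_F, C̄)` (`U = Γ_F`, `F`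
any number field), `Ext¹(ℤ/m, C̄) ≅ C_F/m` (`H¹(Γ_F, C̄) = 0`), `H¹(Γ_F, ℤ/m) = ⋃_L Hom(Gal(L/F), ℤ/m)` over the finite
(abelian) `L ⊆ F̄`, and `α¹(x̄)(χ) = inv(ι[x] ∪ β_m χ)` read at any layer carrying `χ`.  In that currency:

* **`forall_layer_pairing_eq_zero_iff_mem_range_pow`** (INJECTIVITY): `inv_{L/F}(ι[x] ∪ β_m[χ]) = 0` for every finite
  abelian `L ⊆ F̄` and every `χ : Gal(L/F) → ℤ/m` iff `x̄ ∈ C_Fᵐ`.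
* **`exists_idele_forall_layer_pairing_eq`** (SURJECTIVITY): every additive family `Φ_L : Hom(Gal(L/F), ℤ/m) → ℤ/m`
  compatible under `Γ_F ↠ Gal(L/F)` is `χ ↦ −m · inv_{L/F}(ι[x] ∪ β_m[χ])` (i.e. `Φ_L χ / m = −inv_{L/F}(ι[x] ∪ β_m[χ])`
  in `ℚ/ℤ`) for ONE idèle `x`.

HONEST FRAMING: classical global class field theory + Pontryagin duality in the tree's currency; no case of BSD / Poitou–Tate.
Written for Route A (A5) of crux `AnticycControlAdditiveK` (cell bsd-schneider): what remains for Thm. 1.8 (b) over `Γ_F` is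
door-c4's transport `Gal(L/F) ≃* Γ_F ⧸ Γ_L` (N1) and the `Ext`-side Yoneda identity `(δa) ∘ χ = a_*([ε_m] ∘ χ)`.

## References
* J. S. Milne, *Arithmetic Duality Theorems*, 2nd ed. (2006), Ch. I §1, Thm. 1.8 (b). [MilneADT2006]
* J. W. S. Cassels, A. Fröhlich (eds.), *Algebraic Number Theory* (1967), Ch. VII (J. Tate) §5.1, §11.3. [CasselsFrohlichANT1967]
* J. Neukirch, *Class Field Theory — The Bonn Lectures* (2013), Part III Thm. (7.12). [Neukirch2013]
* J.-P. Serre, *Local Fields*, GTM 67 (1979), XI §3, XIII §1, XIV §1. [SerreLocalFields1979]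
-/

noncomputable section

set_option backward.isDefEq.respectTransparency false

namespace Literature.NumberTheory.GaloisRepresentations

namespace IdeleCohomology

open CategoryTheory NumberField groupCohomology Function Field
open Literature.NumberTheory.Automorphic
open Literature.Algebra.Homology Literature.Algebra.Homology.Bockstein IdeleClassGroup
open Literature.AnabelianGeometry.AbsoluteAnabelian.Prop121vii (zmodToQmodZ zmodToQmodZ_apply)

variable {F : Type} [Field F] [NumberField F]

/-- **INJECTIVITY of `α¹(Γ_F, ℤ/m)` on the layers**: for `m ≥ 1` and an idèle `x` of `F`, the class `ι[x]` pairs to zero with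
every Bockstein class of every `ℤ/m`-character of every finite abelian layer `L ⊆ F̄` — `inv_{L/F}(ι[x] ∪ β_m[χ]) = 0` — iff
`x̄ ∈ C_Fᵐ`. [cite: MilneADT2006, Ch. I Thm. 1.8 (b)][cite: CasselsFrohlichANT1967, Ch. VII §11.3, §5.1 Main Theorem (B), (D)]
[cite: Neukirch2013, Part III Thm. (7.12)] -/
theorem forall_layer_pairing_eq_zero_iff_mem_range_pow {m : ℕ} (hm : 0 < m) (x : ideleGroup F) :
    haveI : NeZero m := ⟨hm.ne'⟩
    (∀ (L : IntermediateField F (AlgebraicClosure F)) (_ : FiniteDimensional F L) (_ : IsAbelianGalois F L)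
        (χ : Additive (L ≃ₐ[F] L) →+ ZMod m),
        haveI : NumberField L := NumberField.of_module_finite F L
        classInvAll F L (baseCup (E := L) x
          (δ (intModShortComplex_shortExact (L ≃ₐ[F] L) m) 1 2 rfl
            ((H1IsoOfIsTrivial (Rep.trivial ℤ (L ≃ₐ[F] L) (ZMod m))).inv χ))) = 0) ↔
      (QuotientGroup.mk x : ideleGroup F ⧸ principalIdeles F) ∈
        (@powMonoidHom (ideleGroup F ⧸ principalIdeles F) _ m).range := by
  haveI : NeZero m := ⟨hm.ne'⟩
  rw [mem_range_pow_iff_forall_layer_character hm x]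
  refine forall_congr' fun L => forall_congr' fun hL => forall_congr' fun hab => forall_congr' fun χ => ?_
  haveI := hL
  haveI := hab
  haveI : NumberField L := NumberField.of_module_finite F L
  exact classInvAll_baseCup_bockstein_eq_zero_iff_artinIdeleMap L m χ x

/-- **SURJECTIVITY of `α¹(Γ_F, ℤ/m)` on the layers**: every additive family `Φ_L : Hom(Gal(L/F), ℤ/m) → ℤ/m` over the finite
abelian `L ⊆ F̄`, compatible under `Γ_F ↠ Gal(L/F)`, is represented by ONE idèle `x`:
`Φ_L χ / m = −inv_{L/F}(ι[x] ∪ β_m[χ])` in `ℚ/ℤ` for every `L` and `χ`.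
[cite: MilneADT2006, Ch. I Thm. 1.8 (b)][cite: SerreLocalFields1979, XIII §1][cite: CasselsFrohlichANT1967, Ch. VII §11.3] -/
theorem exists_idele_forall_layer_pairing_eq {m : ℕ} (hm : 0 < m)
    (Φ : (L : IntermediateField F (AlgebraicClosure F)) → (Additive (L ≃ₐ[F] L) →+ ZMod m) → ZMod m)
    (hadd : ∀ (L : IntermediateField F (AlgebraicClosure F)) [FiniteDimensional F L] [IsAbelianGalois F L]
      (χ χ' : Additive (L ≃ₐ[F] L) →+ ZMod m), Φ L (χ + χ') = Φ L χ + Φ L χ')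
    (hcompat : ∀ (L L' : IntermediateField F (AlgebraicClosure F)) [FiniteDimensional F L] [IsAbelianGalois F L]
      [FiniteDimensional F L'] [IsAbelianGalois F L']
      (χ : Additive (L ≃ₐ[F] L) →+ ZMod m) (χ' : Additive (L' ≃ₐ[F] L') →+ ZMod m),
      (∀ γ : absoluteGaloisGroup F,
        χ (Additive.ofMul (absRestrictNormalHom L γ)) = χ' (Additive.ofMul (absRestrictNormalHom L' γ))) →
      Φ L χ = Φ L' χ') :
    haveI : NeZero m := ⟨hm.ne'⟩
    ∃ x : ideleGroup F, ∀ (L : IntermediateField F (AlgebraicClosure F)) (_ : FiniteDimensional F L)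
      (_ : IsAbelianGalois F L) (χ : Additive (L ≃ₐ[F] L) →+ ZMod m),
      haveI : NumberField L := NumberField.of_module_finite F L
      zmodToQmodZ m (Φ L χ) =
        -classInvAll F L (baseCup (E := L) x
          (δ (intModShortComplex_shortExact (L ≃ₐ[F] L) m) 1 2 rfl
            ((H1IsoOfIsTrivial (Rep.trivial ℤ (L ≃ₐ[F] L) (ZMod m))).inv χ))) := by
  haveI : NeZero m := ⟨hm.ne'⟩
  obtain ⟨x, hx⟩ := exists_idele_forall_layer_character_eq hm Φ hadd hcompat
  refine ⟨x, fun L hL hab χ => ?_⟩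
  haveI := hL
  haveI := hab
  haveI : NumberField L := NumberField.of_module_finite F L
  rw [classInvAll_baseCup_bockstein_eq_artinIdeleMap L m χ x, neg_neg, hx L hL hab χ]

end IdeleCohomology

end Literature.NumberTheory.GaloisRepresentations

end
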